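import Summits.CriticalPhenomena.SAWScalingLimit.Theorems.SAWDevelopingMapObservableToSLEHullApproxMulti
import Summits.CriticalPhenomena.SAWScalingLimit.Theorems.SAWDevelopingMapObservableToSLEHullApproxClusterA
import Summits.CriticalPhenomena.SAWScalingLimit.Theorems.SAWDevelopingMapObservableToSLEHullApproxPiece
import Summits.CriticalPhenomena.SAWScalingLimit.Theorems.SAWDevelopingMapObservableToSLEHullApproxArcs
import Summits.CriticalPhenomena.SAWScalingLimit.Theorems.SAWDevelopingMapObservableToSLEHullApproxCollar
import Literature.Probability.RandomPlanarGeometry.JordanDomainProofs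
import HarnessLib

/-!
# Crux `SAWDevelopingMap.ObservableToSLE` (stmt-CriticalPhenomena-10472), line
`floor-ratio-restriction-bootstrap`: STUB 4b, the hull approximation from outside (domain half)

Landing target:
`Summits/CriticalPhenomena/SAWScalingLimit/Theorems/SAWDevelopingMapObservableToSLEHullApproxDomain.lean`
(`--supports stmt-CriticalPhenomena-10472`).

**STUB 4b (`stub_hullApproxDomain`).** Let `φ : (ℍ; 0, ∞) → (D; a, b)` be a chordal uniformizing
map, `D'` a hull subdomain of `D` with pulled-back hull `A = φ.pullbackHull D'` and
`F = cl(φ⁻¹ D') = cl(ℍ ∖ A)`, and let `B ∈ 𝒬*`, `B ⊆ A`, have all its points at distance `≥ r > 0`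
from `F`. Then there is a (Jordan) hull subdomain `D''` of `D` containing `D'` together with a
metric collar `{z ∈ D : dist(z, D') ≤ η}` (`η > 0`) and with `B ⊆ φ.pullbackHull D''`.

Proof (assembling the sibling helper files `…HullApproxCut/Step/Multi/Piece/ClusterA/Arcs/Collar`):

1. **Cluster decomposition** (`stub_hullApproxDomain_cluster`): `B` is the union of finitely many
   one-sided `*`-hulls `C ∈ 𝒬₊ ∪ 𝒬₋` (the CLUSTERS) whose real fillings
   `C' = C ∪ [inf C ∩ ℝ, sup C ∩ ℝ]` are pairwise disjoint and at distance `≥ r/2` from `F`.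
   Construction: the compact real trace of `B` lies in the open far set
   `Z' = {x : dist(x, F) > r/2} ⊆ ℝ`, hence in finitely many of its components `I`; the cluster of
   `I` is the set of points of `B` whose component (in `B`) has a real point in `Ī`. By the
   no-arch lemma (`stub_hullApproxDomain_noArch`, file `…ClusterA`) all real points of a component
   of `B` lie in one component of `Z'`, so the clusters of distinct components are disjoint closed
   sets (`isClosed_componentPiece`) partitioning `B`, hence `*`-hulls (`stub_hullApproxDomain_piece`),
   one-sided because `0 ∉ Z'`, with real traces inside `I ⊆ Z'`.
2. Separate the fillings by the disjoint open sets
   `U_C = {dist(·, C') < dist(·, C'') for all other clusters} ∩ {dist(·, F) > r/4}`; enclose each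
   cluster in a smooth hull `J_C ⊆ U_C` ([LSW] Lemma 2.1, `stub_hullApproxDomain_arcs`); swallow
   the pairwise disjoint smooth hulls one by one by cross-cuts (`stub_hullApproxDomain_multi`:
   Carathéodory + Newman), giving `D'' = φ(ℍ ∖ ⋃ J_C)`; the collar comes from `collar_of_far`
   since `⋃ J_C` is at distance `> r/4` from `F`.
-/

noncomputable section

open scoped Topology NNReal
open Filter Set MeasureTheory Metric Complex Function Bornology
open Literature.Probability.RandomPlanarGeometry
open UpperHalfPlane (upperHalfPlaneSet isOpen_upperHalfPlaneSet)

namespace Summit.CriticalPhenomena.SAWScalingLimit.Theorems.ObservableToSLE.FloorRatio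


/-- A preconnected set of reals missing `0` lies on one side of `0`. [folklore] -/
theorem pos_or_neg_of_isPreconnected {S : Set ℝ} (hS : IsPreconnected S) (h0 : (0 : ℝ) ∉ S) :
    (∀ y ∈ S, 0 < y) ∨ (∀ y ∈ S, y < 0) := by
  by_contra h
  simp only [not_or, not_forall, not_lt, exists_prop] at h
  obtain ⟨⟨y, hy, hy0⟩, ⟨y', hy', hy'0⟩⟩ := h
  have hy0' : y < 0 := lt_of_le_of_ne hy0 fun h ↦ h0 (h ▸ hy)
  have hy'0' : 0 < y' := lt_of_le_of_ne hy'0 fun h ↦ h0 (h ▸ hy')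
  exact h0 (hS.ordConnected.out hy hy' ⟨hy0'.le, hy'0'.le⟩)

/-- **The cluster decomposition of a far hull.** Let `A ∈ 𝒬*`, `F = cl(ℍ ∖ A)`, and let
`B ∈ 𝒬*` be nonempty with all points at distance `≥ r > 0` from `F`. Then `B` is covered by
finitely many one-sided `*`-hulls `C ⊆ B` (`C ∈ 𝒬₊ ∪ 𝒬₋`, nonempty) whose real fillings
`realFill C` are pairwise disjoint and at distance `≥ r/2` from `F` (components of `B` grouped
by the component of the far set `{x ∈ ℝ : dist(x, F) > r/2}` containing their real points;
no-arch lemma from the Jordan curve theorem, `stub_hullApproxDomain_noArch`). Registered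
sub-goal `stub_hullApproxDomain_cluster` of STUB 4b (`stub_hullApproxDomain`). [folklore] -/
theorem stub_hullApproxDomain_cluster :
    ∀ (A B : Set ℂ) (r : ℝ), IsStarHull A → IsStarHull B → B.Nonempty → 0 < r →
      (∀ w ∈ B, r ≤ infDist w (closure (upperHalfPlaneSet \ A))) →
      ∃ S : Finset (Set ℂ),
        (∀ C ∈ S, (IsPlusHull C ∨ IsMinusHull C) ∧ C.Nonempty ∧ C ⊆ B ∧
          ∀ w ∈ realFill C, r / 2 ≤ infDist w (closure (upperHalfPlaneSet \ A))) ∧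
        B ⊆ ⋃₀ (S : Set (Set ℂ)) ∧ (S : Set (Set ℂ)).Pairwise (Disjoint on realFill) := by
  intro A B r hA hB hne hr hfar
  classical
  set F : Set ℂ := closure (upperHalfPlaneSet \ A) with hF
  set Z' : Set ℝ := {x : ℝ | r / 2 < infDist (x : ℂ) F} with hZ'
  have hZ'o : IsOpen Z' :=
    isOpen_lt continuous_const ((continuous_infDist_pt F).comp continuous_ofReal)
  have h0Z' : (0 : ℝ) ∉ Z' := fun h ↦ by
    have h0 : infDist ((0 : ℝ) : ℂ) F = 0 := by
      rw [ofReal_zero]; exact infDist_zero_of_mem hA.zero_mem_closure_diff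
    have h' : r / 2 < infDist ((0 : ℝ) : ℂ) F := h
    linarith
  -- components of the far set
  set I : ℝ → Set ℝ := fun x ↦ connectedComponentIn Z' x with hI
  have hIo : ∀ x, IsOpen (I x) := fun x ↦ hZ'o.connectedComponentIn
  have hIZ' : ∀ x, I x ⊆ Z' := fun x ↦ connectedComponentIn_subset _ _
  have hIpre : ∀ x, IsPreconnected (I x) := fun x ↦ isPreconnected_connectedComponentIn
  have hIeq : ∀ {x z : ℝ}, z ∈ I x → I x = I z := fun hz ↦ connectedComponentIn_eq hz
  have hIdisj : ∀ {x x' : ℝ}, I x ≠ I x' → Disjoint (I x) (I x') := fun hne ↦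
    Set.disjoint_left.2 fun z hz hz' ↦ hne ((hIeq hz).trans (hIeq hz').symm)
  -- the hull `B`
  have hBb := hB.isBoundedHull
  have hBc : IsClosed B := hBb.isClosed
  have hnfB := hBb.isConnected_union_im_nonpos
  have hTZ' : ∀ {x : ℝ}, (x : ℂ) ∈ B → x ∈ Z' := fun hx ↦ by
    show r / 2 < _
    linarith [hfar _ hx]
  have hTc : IsCompact (realTrace B) := isCompact_realTrace hBb.isCompact
  obtain ⟨t, ht⟩ := hTc.elim_finite_subcover I hIo fun x hx ↦
    mem_iUnion.2 ⟨x, mem_connectedComponentIn (hTZ' hx)⟩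
  -- the clusters
  set C : ℝ → Set ℂ := fun x ↦
    {a | a ∈ B ∧ ∃ y : ℝ, y ∈ closure (I x) ∧ (y : ℂ) ∈ connectedComponentIn B a} with hC
  have hCB : ∀ x, C x ⊆ B := fun x a ha ↦ ha.1
  have hCc : ∀ x, IsClosed (C x) := fun x ↦ isClosed_componentPiece hB isClosed_closure
  have hCeq : ∀ {x x' : ℝ}, I x = I x' → C x = C x' := fun {x x'} h ↦ by
    show {a | a ∈ B ∧ ∃ y : ℝ, y ∈ closure (I x) ∧ (y : ℂ) ∈ connectedComponentIn B a} =
      {a | a ∈ B ∧ ∃ y : ℝ, y ∈ closure (I x') ∧ (y : ℂ) ∈ connectedComponentIn B a}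
    rw [h]
  -- all real points of the component of a point of `C x` lie in `I x`
  have hreal : ∀ {x : ℝ} {a : ℂ}, a ∈ C x → ∀ {y' : ℝ}, (y' : ℂ) ∈ connectedComponentIn B a →
      y' ∈ I x := by
    rintro x a ⟨-, y, hy, hya⟩ y' hy'a
    have hyZ' : y ∈ Z' := hTZ' (connectedComponentIn_subset _ _ hya)
    have hyI : y ∈ I x := mem_connectedComponentIn_of_mem_closure hZ'o hy hyZ'
    have h := real_mem_component_of_component hA hB hr hfar hya hy'a
    change y' ∈ I y at h
    rwa [← hIeq hyI] at h
  have hrealC : ∀ {x : ℝ} {y : ℝ}, (y : ℂ) ∈ C x → y ∈ I x := fun h ↦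
    hreal h (mem_connectedComponentIn h.1)
  -- every point of `B` is in some cluster
  have hcover : ∀ {a : ℂ}, a ∈ B → ∃ x ∈ t, a ∈ C x := by
    intro a ha
    obtain ⟨y, -, hya⟩ := hB.exists_real_mem_connectedComponentIn hnfB ha
    have hyT : y ∈ realTrace B := by
      show (y : ℂ) ∈ B
      exact connectedComponentIn_subset _ _ hya
    obtain ⟨x, hx, hyx⟩ := mem_iUnion₂.1 (ht hyT)
    exact ⟨x, hx, ha, y, subset_closure hyx, hya⟩
  -- clusters of distinct components are disjoint
  have hCdisj : ∀ {x x' : ℝ}, I x ≠ I x' → Disjoint (C x) (C x') := by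
    intro x x' hne
    refine Set.disjoint_left.2 fun a ha ha' ↦ ?_
    have ha'' := ha'
    obtain ⟨-, y', -, hy'a⟩ := ha''
    have h1 : y' ∈ I x := hreal ha hy'a
    have h2 : y' ∈ I x' := hreal ha' hy'a
    exact Set.disjoint_left.1 (hIdisj hne) h1 h2
  -- each nonempty cluster is a `*`-hull
  have hstar : ∀ x ∈ t, IsStarHull (C x) := by
    intro x hx
    set S' : Set ℂ := ⋃ x' ∈ t.filter (fun x' ↦ I x' ≠ I x), C x' with hS'
    have hS'c : IsClosed S' := isClosed_biUnion_finset fun x' _ ↦ hCc x'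
    have hunion : C x ∪ S' = B := by
      refine Subset.antisymm (union_subset (hCB x) (iUnion₂_subset fun x' _ ↦ hCB x')) ?_
      intro a ha
      obtain ⟨x', hx', hax'⟩ := hcover ha
      by_cases h : I x' = I x
      · exact Or.inl (hCeq h ▸ hax')
      · exact Or.inr (mem_iUnion₂.2 ⟨x', Finset.mem_filter.2 ⟨hx', h⟩, hax'⟩)
    have hdisj : Disjoint (C x) S' := by
      rw [hS', disjoint_iUnion₂_right]
      intro x' hx'
      exact hCdisj (Ne.symm (Finset.mem_filter.1 hx').2)
    exact stub_hullApproxDomain_piece B (C x) S' hB (hCc x) hS'c hunion hdisj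
  -- sign
  have hside : ∀ x ∈ t, IsPlusHull (C x) ∨ IsMinusHull (C x) := by
    intro x hx
    rcases pos_or_neg_of_isPreconnected (hIpre x) (fun h ↦ h0Z' (hIZ' x h)) with h | h
    · exact Or.inl ⟨hstar x hx, fun y hy ↦ h y (hrealC hy)⟩
    · exact Or.inr ⟨hstar x hx, fun y hy ↦ h y (hrealC hy)⟩
  -- the real filling of a nonempty cluster lies in `C x ∪ I x`
  have hIcc : ∀ x ∈ t, (C x).Nonempty →
      Icc (sInf (realTrace (C x))) (sSup (realTrace (C x))) ⊆ I x := by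
    intro x hx hCne
    have hRc : IsCompact (realTrace (C x)) := isCompact_realTrace (hstar x hx).isBoundedHull.isCompact
    have hRne : (realTrace (C x)).Nonempty := (hstar x hx).isBoundedHull.realTrace_nonempty hCne
    have h1 : sInf (realTrace (C x)) ∈ I x := hrealC (hRc.sInf_mem hRne)
    have h2 : sSup (realTrace (C x)) ∈ I x := hrealC (hRc.sSup_mem hRne)
    exact (hIpre x).ordConnected.out h1 h2
  have hfill : ∀ x ∈ t, (C x).Nonempty → ∀ w ∈ realFill (C x), r / 2 ≤ infDist w F := by
    intro x hx hCne w hw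
    rcases hw with hw | ⟨y, hy, rfl⟩
    · linarith [hfar w (hCB x hw)]
    · exact le_of_lt (hIZ' x (hIcc x hx hCne hy))
  -- the finite set of clusters
  set S : Finset (Set ℂ) := (t.filter fun x ↦ (C x).Nonempty).image C with hS
  have hmemS : ∀ {C' : Set ℂ}, C' ∈ S ↔ ∃ x ∈ t, (C x).Nonempty ∧ C x = C' := by
    intro C'
    rw [hS, Finset.mem_image]
    constructor
    · rintro ⟨x, hx, rfl⟩
      exact ⟨x, (Finset.mem_filter.1 hx).1, (Finset.mem_filter.1 hx).2, rfl⟩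
    · rintro ⟨x, hx, hne, rfl⟩
      exact ⟨x, Finset.mem_filter.2 ⟨hx, hne⟩, rfl⟩
  refine ⟨S, fun C' hC' ↦ ?_, fun a ha ↦ ?_, ?_⟩
  · obtain ⟨x, hx, hCne, rfl⟩ := hmemS.1 hC'
    exact ⟨hside x hx, hCne, hCB x, hfill x hx hCne⟩
  · obtain ⟨x, hx, hax⟩ := hcover ha
    exact ⟨C x, Finset.mem_coe.2 (hmemS.2 ⟨x, hx, ⟨a, hax⟩, rfl⟩), hax⟩
  · intro C₁ hC₁ C₂ hC₂ hne
    obtain ⟨x₁, hx₁, hne₁, rfl⟩ := hmemS.1 (Finset.mem_coe.1 hC₁)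
    obtain ⟨x₂, hx₂, hne₂, rfl⟩ := hmemS.1 (Finset.mem_coe.1 hC₂)
    have hI : I x₁ ≠ I x₂ := fun h ↦ hne (hCeq h)
    have hId := hIdisj hI
    change Disjoint (realFill (C x₁)) (realFill (C x₂))
    refine Set.disjoint_left.2 fun w hw₁ hw₂ ↦ ?_
    rcases hw₁ with hw₁ | ⟨y₁, hy₁, rfl⟩ <;> rcases hw₂ with hw₂ | ⟨y₂, hy₂, hy⟩
    · exact Set.disjoint_left.1 (hCdisj hI) hw₁ hw₂
    · rw [← hy] at hw₁
      exact Set.disjoint_left.1 hId (hrealC hw₁) (hIcc x₂ hx₂ hne₂ hy₂)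
    · exact Set.disjoint_left.1 hId (hIcc x₁ hx₁ hne₁ hy₁) (hrealC hw₂)
    · have : y₂ = y₁ := by exact_mod_cast (show ((y₂ : ℝ) : ℂ) = ((y₁ : ℝ) : ℂ) from hy)
      rw [this] at hy₂
      exact Set.disjoint_left.1 hId (hIcc x₁ hx₁ hne₁ hy₁) (hIcc x₂ hx₂ hne₂ hy₂)



/-- **STUB 4b: the hull approximation from outside, domain half.** For a hull subdomain `D'` of
`(D; a, b)` with chordal uniformizer `φ`, and a `*`-hull `B ⊆ φ.pullbackHull D'` at distance
`≥ r > 0` from `cl(φ⁻¹ D')`, there is a hull subdomain `D'' ⊇ D'` of `D` containing a metric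
collar of `D'` in `D` and with `B ⊆ φ.pullbackHull D''` (clusters, thin smooth hulls by [LSW]
Lemma 2.1, cross-cuts by Carathéodory's and Newman's theorems; see the module docstring).
[cite: LawlerSchrammWerner2003Restriction, Lemma 2.1 (p. 8)] -/
theorem stub_hullApproxDomain :
    ∀ (D D' : DobrushinDomain) (φ : ConformalEquiv upperHalfPlaneSet D.carrier) (B : Set ℂ) (r : ℝ),
      D.IsHullSubdomain D' → D.IsChordalUniformizing φ → IsStarHull B → B ⊆ φ.pullbackHull D' →
      0 < r → (∀ w ∈ B, r ≤ infDist w (closure (φ.pullbackDomain D'))) →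
      ∃ (D'' : DobrushinDomain) (η : ℝ), D.IsHullSubdomain D'' ∧ D'.carrier ⊆ D''.carrier ∧ 0 < η ∧
        (∀ z ∈ D.carrier, infDist z D'.carrier ≤ η → z ∈ D''.carrier) ∧ B ⊆ φ.pullbackHull D'' := by
  intro D D' φ B r hD' hφ hB hBA hr hfar
  classical
  -- the empty hull
  rcases B.eq_empty_or_nonempty with rfl | hBne
  · exact ⟨D, 1, MarkedDomain.isHullSubdomain_self D, hD'.carrier_subset, one_pos,
      fun z hz _ ↦ hz, empty_subset _⟩
  -- the pulled-back hull `A` and the far set `F`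
  set A : Set ℂ := φ.pullbackHull D' with hAdef
  have hA : IsStarHull A := IsStarHull.pullbackHull JordanDomain.isSimplyConnected_holds hφ hD'
  set F : Set ℂ := closure (upperHalfPlaneSet \ A) with hFdef
  have hFeq : closure (φ.pullbackDomain D') = F := by
    rw [hFdef, hAdef, ConformalEquiv.diff_pullbackHull]
  have hfar' : ∀ w ∈ B, r ≤ infDist w F := fun w hw ↦ by rw [← hFeq]; exact hfar w hw
  -- clusters
  obtain ⟨S, hS, hBS, hpair⟩ := stub_hullApproxDomain_cluster A B r hA hB hBne hr hfar'
  -- separating neighbourhoods of the real fillings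
  set U : Set ℂ → Set ℂ := fun C ↦
    (⋂ C' ∈ S.erase C, {w | infDist w (realFill C) < infDist w (realFill C')}) ∩
      {w | r / 4 < infDist w F} with hU
  have hUo : ∀ C, IsOpen (U C) := fun C ↦
    (isOpen_biInter_finset fun C' _ ↦
      isOpen_lt (continuous_infDist_pt _) (continuous_infDist_pt _)).inter
      (isOpen_lt continuous_const (continuous_infDist_pt _))
  have hRc : ∀ C ∈ S, IsClosed (realFill C) := fun C hC ↦ by
    have h := (hS C hC).1
    have hb : IsBoundedHull C := h.elim (fun h ↦ h.1.isBoundedHull) (fun h ↦ h.1.isBoundedHull)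
    exact hb.isClosed.union ((isCompact_Icc.image Complex.continuous_ofReal).isClosed)
  have hRU : ∀ C ∈ S, realFill C ⊆ U C := by
    intro C hC w hw
    refine ⟨mem_iInter₂.2 fun C' hC' ↦ ?_,
      lt_of_lt_of_le (by linarith : r / 4 < r / 2) ((hS C hC).2.2.2 w hw)⟩
    obtain ⟨hne, hC'S⟩ := Finset.mem_erase.1 hC'
    have hdisj : Disjoint (realFill C) (realFill C') :=
      hpair (Finset.mem_coe.2 hC) (Finset.mem_coe.2 hC'S) (Ne.symm hne)
    have hw' : w ∉ realFill C' := fun h ↦ Set.disjoint_left.1 hdisj hw h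
    have hne' : (realFill C').Nonempty := (hS C' hC'S).2.1.mono (subset_realFill C')
    show infDist w (realFill C) < infDist w (realFill C')
    rw [infDist_zero_of_mem hw]
    exact ((hRc C' hC'S).notMem_iff_infDist_pos hne').1 hw'
  have hUdisj : ∀ C ∈ S, ∀ C' ∈ S, C ≠ C' → Disjoint (U C) (U C') := by
    intro C hC C' hC' hne
    refine Set.disjoint_left.2 fun w hw hw' ↦ ?_
    have h1 : infDist w (realFill C) < infDist w (realFill C') :=
      mem_iInter₂.1 hw.1 C' (Finset.mem_erase.2 ⟨Ne.symm hne, hC'⟩)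
    have h2 : infDist w (realFill C') < infDist w (realFill C) :=
      mem_iInter₂.1 hw'.1 C (Finset.mem_erase.2 ⟨hne, hC⟩)
    linarith
  -- thin smooth hulls around the clusters
  have harc : ∀ C ∈ S, ∃ J : Set ℂ, IsArcHull J ∧ (0 : ℂ) ∉ J ∧ C ⊆ J ∧ J ⊆ U C := fun C hC ↦
    stub_hullApproxDomain_arcs C (U C) (hS C hC).1 (hS C hC).2.1 (hUo C) (hRU C hC)
  choose! J hJa hJ0 hCJ hJU using harc
  set SJ : Finset (Set ℂ) := S.image J with hSJ
  have hSJmem : ∀ {J' : Set ℂ}, J' ∈ SJ ↔ ∃ C ∈ S, J C = J' := by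
    intro J'; rw [hSJ, Finset.mem_image]
  have hSJarc : ∀ J' ∈ SJ, IsArcHull J' ∧ (0 : ℂ) ∉ J' := by
    intro J' hJ'
    obtain ⟨C, hC, rfl⟩ := hSJmem.1 hJ'
    exact ⟨hJa C hC, hJ0 C hC⟩
  have hSJpair : (SJ : Set (Set ℂ)).Pairwise Disjoint := by
    intro J₁ hJ₁ J₂ hJ₂ hne
    obtain ⟨C₁, hC₁, rfl⟩ := hSJmem.1 (Finset.mem_coe.1 hJ₁)
    obtain ⟨C₂, hC₂, rfl⟩ := hSJmem.1 (Finset.mem_coe.1 hJ₂)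
    have hC : C₁ ≠ C₂ := fun h ↦ hne (by rw [h])
    exact (hUdisj C₁ hC₁ C₂ hC₂ hC).mono (hJU C₁ hC₁) (hJU C₂ hC₂)
  -- points of the smooth hulls are far from `F`
  have hJfar : ∀ {w : ℂ}, w ∈ ⋃₀ (SJ : Set (Set ℂ)) → r / 4 < infDist w F := by
    rintro w ⟨J', hJ', hw⟩
    obtain ⟨C, hC, rfl⟩ := hSJmem.1 (Finset.mem_coe.1 hJ')
    exact (hJU C hC hw).2
  -- swallow the smooth hulls
  obtain ⟨D'', hD'', hcar⟩ := stub_hullApproxDomain_multi D φ SJ hφ hSJarc hSJpair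
  -- the collar
  obtain ⟨η, hη, hcollar⟩ := collar_of_far D D' φ (r / 4) hD' hφ (by positivity)
  refine ⟨D'', η, hD'', ?_, hη, ?_, ?_⟩
  · -- `D' ⊆ D''`
    intro w hw
    have hwD : w ∈ D.carrier := hD'.carrier_subset hw
    have hz := ConformalEquiv.symm_mapsTo_pullbackDomain (φ := φ) hD'.carrier_subset hw
    have hzF : infDist (φ.symm w) F = 0 := by
      rw [← hFeq]; exact infDist_zero_of_mem (subset_closure hz)
    have hzJ : φ.symm w ∉ ⋃₀ (SJ : Set (Set ℂ)) := fun h ↦ by linarith [hJfar h]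
    rw [hcar]
    exact ⟨φ.symm w, ⟨hz.1, hzJ⟩, φ.apply_symm_apply hwD⟩
  · -- the collar
    intro z hz hzη
    by_contra hzD''
    have hwH : φ.symm z ∈ upperHalfPlaneSet := φ.symm_mapsTo hz
    have hwJ : φ.symm z ∈ ⋃₀ (SJ : Set (Set ℂ)) := by
      by_contra h
      refine hzD'' ?_
      rw [hcar]
      exact ⟨φ.symm z, ⟨hwH, h⟩, φ.apply_symm_apply hz⟩
    have h1 := hcollar (φ.symm z) hwH (by rw [hFeq]; exact le_of_lt (hJfar hwJ))
    rw [φ.apply_symm_apply hz] at h1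
    linarith
  · -- `B ⊆ φ.pullbackHull D''`
    have hsub : B ∩ upperHalfPlaneSet ⊆ upperHalfPlaneSet \ φ.pullbackDomain D'' := by
      rintro b ⟨hbB, hbH⟩
      refine ⟨hbH, fun hbU ↦ ?_⟩
      obtain ⟨C, hC, hbC⟩ := hBS hbB
      have hbJ : b ∈ ⋃₀ (SJ : Set (Set ℂ)) :=
        ⟨J C, Finset.mem_coe.2 (hSJmem.2 ⟨C, Finset.mem_coe.1 hC, rfl⟩), hCJ C hC hbC⟩
      have h2 : φ b ∈ D''.carrier := hbU.2
      rw [hcar] at h2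
      obtain ⟨b', hb', hbb'⟩ := h2
      have : b' = b := φ.injOn hb'.1 hbH hbb'
      exact hb'.2 (this ▸ hbJ)
    rw [← hB.isBoundedHull.closure_inter_eq]
    exact closure_mono hsub

end Summit.CriticalPhenomena.SAWScalingLimit.Theorems.ObservableToSLE.FloorRatio

end
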